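import Literature.Probability.Percolation.CriticalContinuity
import Literature.StrongHypotheses.CriticalPhenomena
import Literature.Probability.FitznerVanDerHofstad2017.MeanFieldD11CertRev7
import Literature.Probability.FitznerVanDerHofstad2017.MeanFieldOfTriangle
import HarnessLib

/-!
# On-path lemma: `percolationContinuityAt d` and the summit vocabulary of `CriticalPhenomena`

CITATION HEADER (PLACEMENT v2). This module is part of a certified REPRODUCTION of:
R. Fitzner, R. van der Hofstad, *Mean-field behavior for nearest-neighbor percolation in d > 10*,
Electron. J. Probab. 22 (2017), no. 43, 1–65 [FvdH17], and *Generalized approach to the non-backtracking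
lace expansion*, Probab. Theory Related Fields 169 (2017), 1041–1119 [NoBLE17] (arXiv:1506.07977, 1506.07969).
Reproduces: the per-dimension form of [NoBLE17] Def. 2.9 / Prop. 2.11 / Thm. 2.10 and its assembly with the
hub tree's NoBLE→infrared→triangle→θ(p_c)=0 chain. Origin: build `lace`, staging package `LaceExpansionHighD`.

The summit `CriticalPhenomena` (hub tree,
`Summits/CriticalPhenomena/Statement.lean`) is the conjunction
`CardyFormulaZ2 ∧ SAWScalingLimit ∧ PercolationContinuityZ3 ∧ Ising3DConformalLimit`; its third
conjunct is the root-level `abbrev PercolationContinuityZ3 := Literature.Probability.Percolation.PercolationContinuityZ3`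
(`Summits/CriticalPhenomena/PercolationContinuityZ3/Statement.lean`), and
`Literature.Probability.Percolation.PercolationContinuityZ3 := PercolationContinuity 3` with
`PercolationContinuity d := theta (zdGraph d) 0 (criticalProbI d) = 0`
(`Literature/Probability/Percolation/CriticalContinuity.lean`).

This file records, by `Iff.rfl` / `rfl` only, that the predicate this package instantiates at `d = 11`
(and types at `d = 10`) is THE SAME predicate `PercolationContinuity d` at a different `d`:
`percolationContinuityAt d` (and the statements layer's `theta_pc_eq_zero d`, `Setup.lean`) is DEFINED as the
tree's `PercolationContinuity d`; the summit conjunct is its `d = 3` instance. Nothing here claims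
anything about `d = 3`.

Revision 2 (build `lace`, lean2 gen 3) adds the `d = 11` RUNG IN THE SUMMIT'S OWN VOCABULARY, from the cited certificate:
`D11.meanField_d11_cert_full : NobleInitialInputsAt 11 D11.Bi D11.bi → NobleImprovementInputsAt 11 D11.cMuC D11.cWeightsC
D11.GammaC D11.Bo D11.bo → MeanField 11` — [FvdH17] Cor. 1.3 in full (`θ(p_c) = 0 ∧ γ = 1 ∧ β = 1 ∧ δ = 2`, bounded ratio,
`MeanFieldExponents.lean`) at `d = 11`: the 36 numerical inequalities of [NoBLE17] Def. 2.9 are discharged by the kernel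
(`D11.nobleCertificate_d11`, `MeanFieldD11Cert.lean`, orders (12,28), two engines — tuple and cited class as recorded in THAT
module's docstring, the single source of truth: revisions 1–2a = tuple U12r, print-faithful + D21(α) + D31, which is since
REFEREE v10 R41 (HOME/DIVERGENCE.md D39, rule KSUP) a FIDELITY certificate of the notebook-wired K cells; revisions 3–5 = the
two-engine KSUP tuple K12; revision 6 = the tuple O12g on the print-faithful cell of record `wborbx + wbg2 + hexprint` (HOME/DIVERGENCE.md
D46 / D34 / D49, REFEREE v34 R-D46c, v36 R-D46d) at orders (12,28), the record until REFEREE v59; SINCE REFEREE v59 R335 THE CERTIFICATE OF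
RECORD IS REVISION 7 = the sibling module `MeanFieldD11CertRev7.lean` — same cell and class, orders (13,28), the β_Δ slot through the corrected
remainder map in the printed wiring (D65) — see Revision 3 below; revision 6 is superseded, kept, not cited), the exponents by the tree's
triangle-condition theorems (`meanField_of_triangle`,
`MeanFieldOfTriangle.lean`); the theorems of this module are generic in the certificate's constants and re-elaborate unchanged;
what remains hypothetical is exactly the two ANALYTIC inputs `hI` (the tables bound the NoBLE coefficients at `p_I`,
[NoBLE17] Prop. 4.5 (i)) and `hS` (the improvement of bounds, [NoBLE17] Prop. 4.5 (ii) with [FvdH17] §§4–6) — see the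
docstrings of `NobleInitialInputsAt` / `NobleImprovementInputsAt` (`NobleInstantiate.lean`) for their exact status.
Its first conjunct is the `d = 11` conjunct of `PercolationContinuityAllDimensions` (`percolationContinuityAllDimensions_iff`).

Revision 3 (build `lace`, lean2 gen 14) adds the SAME two sentences FROM THE CERTIFICATE OF RECORD, revision 7 (`MeanFieldD11CertRev7.lean`,
`D11.nobleCertificate_d11_rev7 : NobleNumericCertificate 11 cMuC cWeightsC gammaC7 GammaC Bi7 Bo7 bi7 bo7`, orders (13,28), cell
`wborbx + wbg2 + hexprint`, class O12g with the corrected β_Δ map — tuple and class as recorded in THAT module's docstring):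
`D11.meanField_d11_cert_rev7_full : NobleInitialInputsAt 11 D11.Bi7 D11.bi7 → NobleImprovementInputsAt 11 D11.cMuC D11.cWeightsC D11.GammaC
D11.Bo7 D11.bo7 → MeanField 11` and its first conjunct `D11.percolationContinuity_conjunct_eleven_rev7 : … → PercolationContinuity 11`.
These are the summit-vocabulary forms of `D11.meanField_d11_cert_rev7`; the two analytic hypotheses are stated at the record's tables
`Bi7/bi7` (at `p_I`; equivalently, by `MeanFieldD11InitTables.lean`, Assumption 4.3 at `p_I` with `Bi7` plus the twelve F-IM table
hypotheses) and `Bo7/bo7` (on the window). The revision-2 theorems over revision 6 (`D11.meanField_d11_cert_full`,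
`D11.percolationContinuity_conjunct_eleven`) are kept verbatim: correct, superseded, not cited. Additive: no statement of revisions 1–2
changes; nothing about any dimension other than `d = 11` is asserted by the new theorems, and nothing about `d = 3`.
-/

noncomputable section

namespace Literature.Probability.FitznerVanDerHofstad2017

open Literature.Probability.Percolation Literature.Probability.LatticeModels

/-! ### On-path theorems over the tree vocabulary (these are what lands in the hub tree) -/

/-- **The summit conjunct is the `d = 3` instance of the family `PercolationContinuity d`**:
`PercolationContinuityZ3 ↔ PercolationContinuity 3`, definitionally (the root-level summit abbrev
`PercolationContinuityZ3` of `Summits/CriticalPhenomena/PercolationContinuityZ3/Statement.lean` unfolds to the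
Literature decl `Literature.Probability.Percolation.PercolationContinuityZ3 := PercolationContinuity 3`). The rung
theorems of this package conclude `PercolationContinuity 11` (and type `PercolationContinuity 10`): the SAME
predicate at a different `d`; nothing here claims anything about `d = 3`.
[cite: FitznerVanDerHofstad2017, §1.1 (θ(p_c) = 0 known for d = 2 and d ≥ 11, open for 3 ≤ d ≤ 10)] -/
theorem percolationContinuityZ3_iff_three : PercolationContinuityZ3 ↔ PercolationContinuity 3 :=
  Iff.rfl

/-- **The dimension ladder is one predicate.** The registered dimension-free conjecture
`Literature.StrongHypotheses.CriticalPhenomena.PercolationContinuityAllDimensions` (bridge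
`percolationContinuityAllDimensions_implies_PercolationContinuityZ3` in `Summits/CriticalPhenomena/StrongHypotheses.lean`)
is, definitionally, the conjunction over `d ≥ 2` of the family `PercolationContinuity d`; the summit conjunct
`PercolationContinuityZ3` is its `d = 3` conjunct (`percolationContinuityZ3_iff_three`) and the rung
`D11.percolationContinuity_d11` (`MeanFieldD11.lean`) gives its `d = 11` conjunct (under the stated hypotheses). [folklore] -/
theorem percolationContinuityAllDimensions_iff :
    Literature.StrongHypotheses.CriticalPhenomena.PercolationContinuityAllDimensions ↔
      ∀ d : ℕ, 2 ≤ d → PercolationContinuity d :=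
  Iff.rfl

/-- Each rung is a conjunct: the dimension-free conjecture gives `PercolationContinuity d` for every `d ≥ 2`
(in particular `d = 3`, the summit conjunct, and `d = 10`, `d = 11`). [folklore] -/
theorem percolationContinuity_of_allDimensions
    (h : Literature.StrongHypotheses.CriticalPhenomena.PercolationContinuityAllDimensions) {d : ℕ} (hd : 2 ≤ d) :
    PercolationContinuity d :=
  h d hd

/-! ### The `d = 11` rung in the summit vocabulary (revision 2) -/

/-- **`d = 11`: mean-field behaviour in full ([FvdH17] Cor. 1.3) from the cited certificate.**  `MeanField 11`, i.e.
`PercolationContinuity 11 ∧ GammaEqOneBoundedRatio 11 ∧ BetaEqOneBoundedRatio 11 ∧ DeltaEqTwoBoundedRatio 11`, from the two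
analytic hypotheses of the `d = 11` certificate: the numerical half (the 36 inequalities of [NoBLE17] Def. 2.9 at the tuple
and in the class recorded in `MeanFieldD11Cert.lean`'s docstring, orders (12,28)) is `D11.nobleCertificate_d11` (kernel arithmetic
on certified numerals),
the passage triangle condition ⇒ exponents is `meanField_of_triangle` (`2 ≤ 11`).  CONDITIONAL exactly on `hI`, `hS` — the
same status as `D11.meanField_d11_cert`, of which this is the summit-vocabulary form.
[cite: FitznerVanDerHofstad2017, Cor. 1.3, EJP p. 6; Prop. 2.4, EJP p. 14] [cite: FitznerVanDerHofstad2016NoBLE, Def. 2.9, Prop. 2.11, PTRF p. 1060] -/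
theorem D11.meanField_d11_cert_full (hI : NobleInitialInputsAt 11 D11.Bi D11.bi)
    (hS : NobleImprovementInputsAt 11 D11.cMuC D11.cWeightsC D11.GammaC D11.Bo D11.bo) : MeanField 11 :=
  meanField_of_triangle (by norm_num) (D11.meanField_d11_cert hI hS).1

/-- The `d = 11` conjunct of the dimension-free conjecture `PercolationContinuityAllDimensions`
(`percolationContinuityAllDimensions_iff`), from the cited certificate under the same two analytic hypotheses; the summit
conjunct `PercolationContinuityZ3` is the `d = 3` conjunct (`percolationContinuityZ3_iff_three`) and is NOT touched.
[cite: FitznerVanDerHofstad2017, Cor. 1.3, EJP p. 6] -/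
theorem D11.percolationContinuity_conjunct_eleven (hI : NobleInitialInputsAt 11 D11.Bi D11.bi)
    (hS : NobleImprovementInputsAt 11 D11.cMuC D11.cWeightsC D11.GammaC D11.Bo D11.bo) : PercolationContinuity 11 :=
  (D11.meanField_d11_cert_full hI hS).1

/-! ### The `d = 11` rung in the summit vocabulary, from the certificate of record (revision 3) -/

/-- **`d = 11`: mean-field behaviour in full ([FvdH17] Cor. 1.3) from the CERTIFICATE OF RECORD (revision 7).**  `MeanField 11`, i.e.
`PercolationContinuity 11 ∧ GammaEqOneBoundedRatio 11 ∧ BetaEqOneBoundedRatio 11 ∧ DeltaEqTwoBoundedRatio 11`, from the two analytic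
hypotheses of the `d = 11` certificate of record: the numerical half (the 36 inequalities of [NoBLE17] Def. 2.9 at the tuple and in the
class recorded in `MeanFieldD11CertRev7.lean`'s docstring, orders (13,28)) is `D11.nobleCertificate_d11_rev7` (kernel arithmetic on
certified numerals), the passage triangle condition ⇒ exponents is `meanField_of_triangle` (`2 ≤ 11`).  CONDITIONAL exactly on `hI`, `hS`
— the same status as `D11.meanField_d11_cert_rev7`, of which this is the summit-vocabulary form: `hI` = [NoBLE17] Prop. 4.5 (i) at `p_I`
with the record's tables `Bi7/bi7` (its (S2b) half is wired to the twelve F-IM table hypotheses in `MeanFieldD11InitTables.lean`), `hS` =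
the improvement of bounds on the window with `Bo7/bo7` ([NoBLE17] Prop. 4.5 (ii), [FvdH17] §§4–6); neither is a cited fact.
[cite: FitznerVanDerHofstad2017, Cor. 1.3, EJP p. 6; Prop. 2.4, EJP p. 14] [cite: FitznerVanDerHofstad2016NoBLE, Def. 2.9, Prop. 2.11, PTRF p. 1060] -/
theorem D11.meanField_d11_cert_rev7_full (hI : NobleInitialInputsAt 11 D11.Bi7 D11.bi7)
    (hS : NobleImprovementInputsAt 11 D11.cMuC D11.cWeightsC D11.GammaC D11.Bo7 D11.bo7) : MeanField 11 :=
  meanField_of_triangle (by norm_num) (D11.meanField_d11_cert_rev7 hI hS).1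

/-- The `d = 11` conjunct of the dimension-free conjecture `PercolationContinuityAllDimensions`
(`percolationContinuityAllDimensions_iff`), from the certificate of record (revision 7) under the same two analytic hypotheses; the
summit conjunct `PercolationContinuityZ3` is the `d = 3` conjunct (`percolationContinuityZ3_iff_three`) and is NOT touched.
[cite: FitznerVanDerHofstad2017, Cor. 1.3, EJP p. 6] -/
theorem D11.percolationContinuity_conjunct_eleven_rev7 (hI : NobleInitialInputsAt 11 D11.Bi7 D11.bi7)
    (hS : NobleImprovementInputsAt 11 D11.cMuC D11.cWeightsC D11.GammaC D11.Bo7 D11.bo7) : PercolationContinuity 11 :=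
  (D11.meanField_d11_cert_rev7_full hI hS).1

end Literature.Probability.FitznerVanDerHofstad2017

end
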